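import Summits.BirchSwinnertonDyer.BirchSwinnertonDyer.Theorems.AlignedTransportAtTwoMainConjectureOfRankZeroBSDAtTwoFineRoadQiCrux
import HarnessLib

/-!
# Route `AlignedTransportAtTwo`, crux C2 `MainConjectureOfRankZeroBSDAtTwo` (stmt-BirchSwinnertonDyer-22298):
# road (b′) — the ODD BRANCH IS IDLE (stub Mu⁻ of line `birth` v3 is not load-bearing)

HONEST FRAMING (cell `bsd-f1-sign2`, WIDTH-5 attached prover seat `bsd-line-att-p3` gen 2, line `birth` of the
lead `bsd-line-att-p2`; BSD is NOT proved by any of this). THEOREMS ONLY; nothing asserted. A tightness /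
idleness pass on the REGISTERED data stubs of skeleton `4cdab57b` (stubs P / T / K₂′ `stub_katoFineDataQiAtTwo` /
Mu⁻ `stub_oddBranchMuZeroAtTwo` / A₂′ `stub_conjAQiSeedsAtTwo`).

* §1 (pure algebra of `Λ = ℤ₂⟦T⟧`). `a + b` and `a − b` differ by `2b ∈ (2)`, so `a − b ∉ (2) ↔ a + b ∉ (2)`
  (`sub_not_mem_augIdealP_two_iff`). Consequently, in Kato's two-branch shape `a + b = s₊·G₊`,
  `a − b = s₋·G₋` with `s_± ∉ (2)` (the `(c,d)`-factors), the two branches have the SAME `μ`-vanishing: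
  `red G₊ = 0 ↔ red G₋ = 0` (`red_eq_zero_iff_of_twoBranch`). This is the falsifiability handle of the
  displayed stub K₂′: a single seed with `μ(L₂⁺) = 0 < μ(L₂⁻(χ₋₄))` refutes K₂′ AS DISPLAYED
  (`red_minus_eq_zero_iff_red_plus_of_katoFineDataQi`), and it is what the cell's data ask D-att-p2-2 reads on.
* §2 (crux level). In the lead's `seedMuZeroAtTwo_of_fineRoadQi` (road (b′): P + K₂′ + Mu⁻ + A₂′ ⟹ T) the ONLY
  use of the odd-branch analytic `μ₂ = 0` (Mu⁻) is `a − b ∉ (2)`, which §1 derives from `a + b ∉ (2)`, i.e. from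
  the crux's OWN even-branch binder `red G₊ ≠ 0` and `s₊ ∉ (2)`. Hence `seedMuZeroAtTwo_of_fineRoadQi_even`:
  P (modularity) + K₂′ + A₂′ ⟹ T with NO Mu⁻, and `mainConjectureOfRankZeroBSDAtTwo_of_fineRoadQi_even`: C2 BY
  NAME from PRINT + K₂′ + A₂′. On road (b′) the registered stub `stub_oddBranchMuZeroAtTwo` (and the clauses
  `a − b = s₋·G₋`, `s₋ ∉ (2)` of K₂′) can be dropped from the composition; the crux stays CONDITIONAL on K₂′
  (Kato's §17.13 data over `ℚ(ζ_{2^∞})`, displayed) and A₂′ (statement (A) at `2` over `ℚ(i)`, open).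

References: K. Kato, Astérisque 295 (2004), §12.1, Thm. 12.6, Thm. 16.6, Prop. 17.11, §17.13; B. Mazur, J. Tate,
J. Teitelbaum, Invent. Math. 84 (1986) §I.12–I.13; J. Coates, R. Sujatha, Math. Ann. 331 (2005) §3;
R. Greenberg, LNM 1716 (1999) Conj. 1.11, Thm. 4.1.
-/

set_option linter.dupNamespace false
set_option autoImplicit false

noncomputable section

open scoped Classical

open Literature.NumberTheory.EllipticCurves Literature.NumberTheory.EllipticCurves.Module

namespace Summit.BirchSwinnertonDyer.BirchSwinnertonDyer.Theorems.AlignedTransportAtTwoFineRoad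

/-! ## §1 The two branches have the same `μ`-vanishing -/

section Algebra

open Summit.BirchSwinnertonDyer.Rank1Residual.X1.MuLambda

/-- `2 ∈ (2) ⊂ ℤ₂⟦T⟧`. [folklore] -/
theorem two_mem_augIdealP_two : (2 : IwasawaAlgebra 2) ∈ IwasawaAlgebra.augIdealP 2 := by
  rw [IwasawaAlgebra.augIdealP, Ideal.mem_span_singleton]
  refine ⟨1, ?_⟩
  rw [mul_one]
  norm_cast

/-- In `ℤ₂⟦T⟧`: `a − b ∈ (2) ↔ a + b ∈ (2)` (they differ by `2b`). [folklore] -/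
theorem sub_mem_augIdealP_two_iff (a b : IwasawaAlgebra 2) :
    a - b ∈ IwasawaAlgebra.augIdealP 2 ↔ a + b ∈ IwasawaAlgebra.augIdealP 2 := by
  have h2b : 2 * b ∈ IwasawaAlgebra.augIdealP 2 := Ideal.mul_mem_right _ _ two_mem_augIdealP_two
  constructor
  · intro h
    have : a + b = (a - b) + 2 * b := by ring
    rw [this]
    exact Ideal.add_mem _ h h2b
  · intro h
    have : a - b = (a + b) - 2 * b := by ring
    rw [this]
    exact Ideal.sub_mem _ h h2b

/-- In `ℤ₂⟦T⟧`: `a − b ∉ (2) ↔ a + b ∉ (2)`. [folklore] -/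
theorem sub_not_mem_augIdealP_two_iff (a b : IwasawaAlgebra 2) :
    a - b ∉ IwasawaAlgebra.augIdealP 2 ↔ a + b ∉ IwasawaAlgebra.augIdealP 2 :=
  not_congr (sub_mem_augIdealP_two_iff a b)

/-- `red G = 0 ↔ G ∈ (p)` (the `μ > 0` reading of the reduction map). [folklore] -/
theorem red_eq_zero_iff_mem_augIdealP {p : ℕ} [Fact p.Prime] (G : IwasawaAlgebra p) :
    red G = 0 ↔ G ∈ IwasawaAlgebra.augIdealP p := by
  rw [red_eq_zero_iff, IwasawaAlgebra.augIdealP, Ideal.mem_span_singleton]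

/-- For `s ∉ (p)`: `s·G ∈ (p) ↔ G ∈ (p)` (`(p)` is prime). [folklore] -/
theorem mul_mem_augIdealP_iff_of_not_mem {p : ℕ} [Fact p.Prime] {s : IwasawaAlgebra p}
    (hs : s ∉ IwasawaAlgebra.augIdealP p) (G : IwasawaAlgebra p) :
    s * G ∈ IwasawaAlgebra.augIdealP p ↔ G ∈ IwasawaAlgebra.augIdealP p :=
  ⟨fun h => ((IwasawaAlgebra.isPrime_augIdealP_holds p).mem_or_mem h).resolve_left hs,
    fun h => Ideal.mul_mem_left _ _ h⟩

/-- **THE TWO BRANCHES HAVE THE SAME `μ`-VANISHING** in Kato's two-branch shape at `2`: if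
`a + b = s₊·G₊`, `a − b = s₋·G₋` with `s_± ∉ (2)`, then `red G₊ = 0 ↔ red G₋ = 0` — because
`2a = s₊G₊ + s₋G₋` reduces to `s̄₊·Ḡ₊ = s̄₋·Ḡ₋` in the domain `𝔽₂⟦T⟧` with `s̄_± ≠ 0`. This is a NECESSARY
CONDITION of the displayed stub K₂′ (`KatoFineDataQiAtTwo`) of line `birth`, checkable per seed.
[cite: Kato2004Asterisque, Thm. 12.6 and Thm. 16.6 (the (c,d)-zeta elements and their images, pp. 229–268)] -/
theorem red_eq_zero_iff_of_twoBranch {a b sp sm Gp Gm : IwasawaAlgebra 2} (hab : a + b = sp * Gp)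
    (hamb : a - b = sm * Gm) (hsp : sp ∉ IwasawaAlgebra.augIdealP 2)
    (hsm : sm ∉ IwasawaAlgebra.augIdealP 2) : red Gp = 0 ↔ red Gm = 0 := by
  rw [red_eq_zero_iff_mem_augIdealP, red_eq_zero_iff_mem_augIdealP,
    ← mul_mem_augIdealP_iff_of_not_mem hsp Gp, ← mul_mem_augIdealP_iff_of_not_mem hsm Gm, ← hab, ← hamb,
    sub_mem_augIdealP_two_iff]

/-- One-branch form used by the glue: `a + b ∉ (2)` ⟹ `a − b ∉ (2)`. [folklore] -/
theorem sub_not_mem_augIdealP_two_of_add {a b : IwasawaAlgebra 2} (h : a + b ∉ IwasawaAlgebra.augIdealP 2) :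
    a - b ∉ IwasawaAlgebra.augIdealP 2 :=
  (sub_not_mem_augIdealP_two_iff a b).mpr h

end Algebra

/-! ## §2 Road (b′) without the odd branch -/

section Crux

open CongruenceSubgroup WeierstrassCurve Literature.NumberTheory.EllipticCurves.ModularForms
  Literature.NumberTheory.EllipticCurves.Greenberg1999
  Literature.NumberTheory.EllipticCurves.Rank1Residual
  Summit.BirchSwinnertonDyer.Rank1Residual Summit.BirchSwinnertonDyer.Rank1Residual.X1.MuLambda
  Summit.BirchSwinnertonDyer.Rank1Residual.X5 Summit.BirchSwinnertonDyer.Rank1Residual.F1Sign2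
  Summit.BirchSwinnertonDyer.BirchSwinnertonDyer.Theorems.Rank1ResidualX1Defs
  Summit.BirchSwinnertonDyer.BirchSwinnertonDyer.Theses.AlignedTransportAtTwo

/-- **The odd-branch `μ` is determined by the even one under K₂′.** For a curve `W`, a cyclotomic datum
`(κ, γ)` with `γ` a topological generator, and ANY two elements `G₊, G₋ ∈ Λ` (read: integral lifts of `L₂(f, α)`
and of `L₂⁻(f, α, ω, T)`): if Kato's two-branch data over `ℚ(ζ_{2^∞})` exist AS DISPLAYED in stub K₂′ of line
`birth` for every dual datum `D` of `(W, κ, γ)` (one exists: `selmerDualData`), then `red G₋ = 0 ↔ red G₊ = 0`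
(only the clauses `a + b = s₊·G₊`, `a − b = s₋·G₋`, `s_± ∉ (2)` are used). In particular the registered stub Mu⁻
(`OddBranchMuZeroAtTwo`) restricted to these lifts FOLLOWS from K₂′ and the crux's even-branch binder, and a
seed with `μ(L₂⁺) = 0 < μ(L₂⁻)` would REFUTE K₂′ as displayed.
[cite: Kato2004Asterisque, Thm. 12.6, Thm. 16.6, Prop. 17.11, §17.13 (pp. 229–280)] [cite: MazurTateTeitelbaum1986Invent, §I.12–I.13] -/
theorem red_minus_eq_zero_iff_red_plus_of_katoFineDataQi (W : WeierstrassCurve ℚ) [W.IsElliptic]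
    [W.IsGloballyMinimal] {κ : ZpExtension ℚ 2} {γ : Field.absoluteGaloisGroup ℚ} (hγ : κ.IsTopGenerator γ)
    {Gp Gm : IwasawaAlgebra 2}
    (hK2' : ∀ D : W.SelmerDualData κ γ,
        ∃ (K : Type) (_ : Field K) (_ : NumberField K) (V' : WeierstrassCurve K)
          (κK : ZpExtension K 2) (γK : Field.absoluteGaloisGroup K) (YdK : V'.FineSelmerDualData κK γK)
          (H P X' : Type) (_ : AddCommGroup H) (_ : _root_.Module (IwasawaAlgebra 2) H)
          (_ : AddCommGroup P) (_ : _root_.Module (IwasawaAlgebra 2) P)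
          (_ : AddCommGroup X') (_ : _root_.Module (IwasawaAlgebra 2) X')
          (loc : H →ₗ[IwasawaAlgebra 2] P) (toX : P →ₗ[IwasawaAlgebra 2] X')
          (π : X' →ₗ[IwasawaAlgebra 2] YdK.X)
          (col : P →ₗ[IwasawaAlgebra 2] IwasawaAlgebra 2 × IwasawaAlgebra 2)
          (z₁ z₂ : H) (a b sp sm : IwasawaAlgebra 2) (fd : X' →ₗ[IwasawaAlgebra 2] D.X),
          Module.finrank ℚ K = 2 ∧ NumberField.discr K = -4 ∧
          (∃ C : VariableChange K, C • W.baseChange K = V') ∧ κK.IsCyclotomic ∧ κK.IsTopGenerator γK ∧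
          Function.Injective col ∧ (∀ h, toX (loc h) = 0) ∧ Function.Exact toX π ∧
          col (loc z₁) = (a, b) ∧ col (loc z₂) = (b, a) ∧ a + b = sp * Gp ∧ a - b = sm * Gm ∧
          sp ∉ IwasawaAlgebra.augIdealP 2 ∧ sm ∉ IwasawaAlgebra.augIdealP 2 ∧
          Finite (D.X ⧸ LinearMap.range fd)) :
    red Gm = 0 ↔ red Gp = 0 := by
  obtain ⟨K, _, _, V', κK, γK, YdK, H, P, X', _, _, _, _, _, _, loc, toX, π, col, z₁, z₂, a, b, sp,
    sm, fd, -, -, -, -, -, -, -, -, -, -, hab, hamb, hsp, hsm, -⟩ := hK2' (W.selmerDualData κ hγ)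
  exact (red_eq_zero_iff_of_twoBranch hab hamb hsp hsm).symm

/-- **Stub T of line `birth` on road (b′) WITHOUT the odd branch.** As the lead's
`seedMuZeroAtTwo_of_fineRoadQi` (modularity + the displayed Kato data K₂′ over `ℚ(ζ_{2^∞})` for a `ℚ(i)`-model
+ statement (A) at `2` over `ℚ(i)` for the seeds ⟹ `μ₂(X(W/ℚ_∞)) = 0` on the seed cell), but with NO hypothesis on
the odd branch: the per-datum bookkeeping needs `a + b ∉ (2)` and `a − b ∉ (2)`, the first is `s₊ ∉ (2)` + the
crux's even-branch binder `red G₊ ≠ 0`, and the second follows from the first (`(a+b) − (a−b) = 2b`). The clauses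
`a − b = s₋·G₋`, `s₋ ∉ (2)` of K₂′ are carried but unused. CONDITIONAL on K₂′ and A₂′; nothing asserted.
[cite: Kato2004Asterisque, §12.1, Thm. 12.6, Thm. 16.6, Prop. 17.11, §17.13 (pp. 219–280)]
[cite: CoatesSujatha2005, statement (A) (§3)] [cite: GreenbergLNM1716, Conj. 1.11 (p. 58)] -/
theorem seedMuZeroAtTwo_of_fineRoadQi_even (hmod : nonempty_modularParametrizationData)
    (hK2' : ∀ (W : WeierstrassCurve ℚ) [W.IsElliptic] [W.IsGloballyMinimal], IsOrdinaryAt W 2 →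
      (∀ x : ℚ, ¬ HasRationalTwoTorsionX W x) →
      ∀ (κ : ZpExtension ℚ 2) (γ : Field.absoluteGaloisGroup ℚ), κ.IsCyclotomic →
      κ.IsTopGenerator γ → IsCyclotomicVariable 2 γ →
      ∀ ⦃N : ℕ⦄ [NeZero N] (f : CuspForm (Gamma0 N) 2), IsNewformOf W f →
      ∀ Gp Gm : IwasawaAlgebra 2,
        iwasawaToPowerSeries 2 Gp = padicLFunction f (unitRoot W 2 : ℚ_[2]) →
        iwasawaToPowerSeries 2 Gm = padicLFunctionMinusBranch f (unitRoot W 2 : ℚ_[2]) 1 →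
      ∀ D : W.SelmerDualData κ γ,
        ∃ (K : Type) (_ : Field K) (_ : NumberField K) (V' : WeierstrassCurve K)
          (κK : ZpExtension K 2) (γK : Field.absoluteGaloisGroup K) (YdK : V'.FineSelmerDualData κK γK)
          (H P X' : Type) (_ : AddCommGroup H) (_ : _root_.Module (IwasawaAlgebra 2) H)
          (_ : AddCommGroup P) (_ : _root_.Module (IwasawaAlgebra 2) P)
          (_ : AddCommGroup X') (_ : _root_.Module (IwasawaAlgebra 2) X')
          (loc : H →ₗ[IwasawaAlgebra 2] P) (toX : P →ₗ[IwasawaAlgebra 2] X')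
          (π : X' →ₗ[IwasawaAlgebra 2] YdK.X)
          (col : P →ₗ[IwasawaAlgebra 2] IwasawaAlgebra 2 × IwasawaAlgebra 2)
          (z₁ z₂ : H) (a b sp sm : IwasawaAlgebra 2) (fd : X' →ₗ[IwasawaAlgebra 2] D.X),
          Module.finrank ℚ K = 2 ∧ NumberField.discr K = -4 ∧
          (∃ C : VariableChange K, C • W.baseChange K = V') ∧ κK.IsCyclotomic ∧ κK.IsTopGenerator γK ∧
          Function.Injective col ∧ (∀ h, toX (loc h) = 0) ∧ Function.Exact toX π ∧
          col (loc z₁) = (a, b) ∧ col (loc z₂) = (b, a) ∧ a + b = sp * Gp ∧ a - b = sm * Gm ∧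
          sp ∉ IwasawaAlgebra.augIdealP 2 ∧ sm ∉ IwasawaAlgebra.augIdealP 2 ∧
          Finite (D.X ⧸ LinearMap.range fd))
    (hA2K : ∀ (W : WeierstrassCurve ℚ) [W.IsElliptic] [W.IsGloballyMinimal], ¬ W.HasCM →
      IsOrdinaryAt W 2 → (∀ x : ℚ, ¬ HasRationalTwoTorsionX W x) → ¬ IsSquare W.Δ →
      W.analyticRank = 0 → BSDp W 2 →
      ∀ (K : Type) [Field K] [NumberField K] (V' : WeierstrassCurve K),
        Module.finrank ℚ K = 2 → NumberField.discr K = -4 →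
        (∃ C : VariableChange K, C • W.baseChange K = V') →
        ∀ κK : ZpExtension K 2, κK.IsCyclotomic → Set.Finite {s : V'.fineSelmerInfty κK | 2 • s = 0}) :
    ∀ (W : WeierstrassCurve ℚ) [W.IsElliptic] [W.IsGloballyMinimal], ¬ W.HasCM →
      IsOrdinaryAt W 2 → (∀ x : ℚ, ¬ HasRationalTwoTorsionX W x) → ¬ IsSquare W.Δ →
      W.analyticRank = 0 →
      (∀ ⦃N : ℕ⦄ [NeZero N] (f : CuspForm (Gamma0 N) 2), IsNewformOf W f →
        ∀ G : IwasawaAlgebra 2, IsEvenBranchLiftAtTwo W f G → red G ≠ 0) →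
      BSDp W 2 →
      ∀ (κ : ZpExtension ℚ 2) (γ : Field.absoluteGaloisGroup ℚ), κ.IsCyclotomic →
        κ.IsTopGenerator γ → IsCyclotomicVariable 2 γ →
        ∀ D : W.SelmerDualData κ γ, D.IsTorsion → D.mu = 0 := by
  intro W _ _ hcm hord ht hsq hr hμan hbsd κ γ hκ hγ hγ' D _
  have hirr : Irr W 2 := AlignedTransportAtTwoSeed.irr_two_of_forall_not_hasRationalTwoTorsionX W ht
  haveI : NeZero (W.conductorNorm ℤ) := ⟨(W.conductorNorm_pos_holds).ne'⟩
  obtain ⟨Dm⟩ := hmod W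
  obtain ⟨Gp, hGp⟩ := exists_iwasawaToPowerSeries_eq_padicLFunction_two hord Dm.isNewformOf hirr
  obtain ⟨Gm, hGm⟩ :=
    exists_iwasawaToPowerSeries_eq_padicLFunctionMinusBranch_two hord Dm.isNewformOf odd_one
  have hredp : red Gp ≠ 0 := hμan Dm.f Dm.isNewformOf Gp (Or.inl ⟨hord, hGp⟩)
  obtain ⟨K, _, _, V', κK, γK, YdK, H, P, X', _, _, _, _, _, _, loc, toX, π, col, z₁, z₂, a, b, sp,
    sm, fd, hK2, hK4, hV', hκK, hγK, hcol, h0, hX, hz₁, hz₂, hab, -, hsp, -, hfd⟩ :=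
    hK2' W hord ht κ γ hκ hγ hγ' Dm.f Dm.isNewformOf Gp Gm hGp hGm D
  have hA := hA2K W hcm hord ht hsq hr hbsd K V' hK2 hK4 hV' κK hκK
  have hY := lengthAt_fineSelmerDual_eq_zero_of_finite_twoTorsion_numberField V' hγK YdK hA
  have ha : a + b ∉ IwasawaAlgebra.augIdealP 2 :=
    hab ▸ mul_not_mem_augIdealP hsp (not_mem_augIdealP_of_red_ne_zero hredp)
  have hb : a - b ∉ IwasawaAlgebra.augIdealP 2 := sub_not_mem_augIdealP_two_of_add ha
  haveI := hfd
  exact selmerDual_mu_eq_zero_of_twoBranchSkeleton_two W D loc toX π col hcol h0 hX hz₁ hz₂ ha hb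
    hY fd hfd

/-- **C2 BY NAME on road (b′) without the odd branch.** PRINT {Kato 17.4 (1)(2) at `2`, Greenberg 4.1, period
unit, modularity, GZK} + the displayed Kato data over `ℚ(ζ_{2^∞})` (K₂′) + statement (A) at `2` over `ℚ(i)` for
the seeds (A₂′) ⟹ `MainConjectureOfRankZeroBSDAtTwo` — the registered stub Mu⁻ (`OddBranchMuZeroAtTwo`) is NOT
needed. CONDITIONAL: the item stays open (K₂′ displayed, A₂′ open); compare the lead's
`mainConjectureOfRankZeroBSDAtTwo_of_fineRoadQi` (with Mu⁻) and road (b″) (`…FineRoadCoinvCruxArch`).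
[cite: Kato2004Asterisque, Thm. 17.4 (p. 273) and §17.13 (pp. 279–280)]
[cite: GreenbergLNM1716, Thm. 4.1 (p. 102) and Conj. 1.11 (p. 58)] -/
theorem mainConjectureOfRankZeroBSDAtTwo_of_fineRoadQi_even
    (h17 : ∀ (V : WeierstrassCurve ℚ) [V.IsElliptic] [V.IsGloballyMinimal] [NeZero (V.conductorNorm ℤ)]
      (f : CuspForm (Gamma0 (V.conductorNorm ℤ)) 2), kato_divisibility_allPrimes V 2 (f := f))
    (hGr : Greenberg1999.thm41_charValue_rankZero_anyPrime)
    (hper : realPeriodRat_eq_unit_mul_plusPeriod_two) (hmod : nonempty_modularParametrizationData)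
    (hGZK : rank_eq_analyticRank_of_analyticRank_le_one)
    (hK2' : ∀ (W : WeierstrassCurve ℚ) [W.IsElliptic] [W.IsGloballyMinimal], IsOrdinaryAt W 2 →
      (∀ x : ℚ, ¬ HasRationalTwoTorsionX W x) →
      ∀ (κ : ZpExtension ℚ 2) (γ : Field.absoluteGaloisGroup ℚ), κ.IsCyclotomic →
      κ.IsTopGenerator γ → IsCyclotomicVariable 2 γ →
      ∀ ⦃N : ℕ⦄ [NeZero N] (f : CuspForm (Gamma0 N) 2), IsNewformOf W f →
      ∀ Gp Gm : IwasawaAlgebra 2,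
        iwasawaToPowerSeries 2 Gp = padicLFunction f (unitRoot W 2 : ℚ_[2]) →
        iwasawaToPowerSeries 2 Gm = padicLFunctionMinusBranch f (unitRoot W 2 : ℚ_[2]) 1 →
      ∀ D : W.SelmerDualData κ γ,
        ∃ (K : Type) (_ : Field K) (_ : NumberField K) (V' : WeierstrassCurve K)
          (κK : ZpExtension K 2) (γK : Field.absoluteGaloisGroup K) (YdK : V'.FineSelmerDualData κK γK)
          (H P X' : Type) (_ : AddCommGroup H) (_ : _root_.Module (IwasawaAlgebra 2) H)
          (_ : AddCommGroup P) (_ : _root_.Module (IwasawaAlgebra 2) P)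
          (_ : AddCommGroup X') (_ : _root_.Module (IwasawaAlgebra 2) X')
          (loc : H →ₗ[IwasawaAlgebra 2] P) (toX : P →ₗ[IwasawaAlgebra 2] X')
          (π : X' →ₗ[IwasawaAlgebra 2] YdK.X)
          (col : P →ₗ[IwasawaAlgebra 2] IwasawaAlgebra 2 × IwasawaAlgebra 2)
          (z₁ z₂ : H) (a b sp sm : IwasawaAlgebra 2) (fd : X' →ₗ[IwasawaAlgebra 2] D.X),
          Module.finrank ℚ K = 2 ∧ NumberField.discr K = -4 ∧
          (∃ C : VariableChange K, C • W.baseChange K = V') ∧ κK.IsCyclotomic ∧ κK.IsTopGenerator γK ∧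
          Function.Injective col ∧ (∀ h, toX (loc h) = 0) ∧ Function.Exact toX π ∧
          col (loc z₁) = (a, b) ∧ col (loc z₂) = (b, a) ∧ a + b = sp * Gp ∧ a - b = sm * Gm ∧
          sp ∉ IwasawaAlgebra.augIdealP 2 ∧ sm ∉ IwasawaAlgebra.augIdealP 2 ∧
          Finite (D.X ⧸ LinearMap.range fd))
    (hA2K : ∀ (W : WeierstrassCurve ℚ) [W.IsElliptic] [W.IsGloballyMinimal], ¬ W.HasCM →
      IsOrdinaryAt W 2 → (∀ x : ℚ, ¬ HasRationalTwoTorsionX W x) → ¬ IsSquare W.Δ →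
      W.analyticRank = 0 → BSDp W 2 →
      ∀ (K : Type) [Field K] [NumberField K] (V' : WeierstrassCurve K),
        Module.finrank ℚ K = 2 → NumberField.discr K = -4 →
        (∃ C : VariableChange K, C • W.baseChange K = V') →
        ∀ κK : ZpExtension K 2, κK.IsCyclotomic → Set.Finite {s : V'.fineSelmerInfty κK | 2 • s = 0}) :
    MainConjectureOfRankZeroBSDAtTwo :=
  AlignedTransportAtTwoSeed.mainConjectureOfRankZeroBSDAtTwo_of_seedMuZero h17 hGr hper hmod hGZK
    (seedMuZeroAtTwo_of_fineRoadQi_even hmod hK2' hA2K)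

end Crux

end Summit.BirchSwinnertonDyer.BirchSwinnertonDyer.Theorems.AlignedTransportAtTwoFineRoad

end
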